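import Summits.HubbardSuperconductivity.HubbardSuperconductivity.Theorems.WeakCouplingBCSDefsKlCertTPrime
import Summits.HubbardSuperconductivity.HubbardSuperconductivity.Theorems.WeakCouplingBCSKlCertTPrimeLindhardD4
import Literature.MathematicalPhysics.QuantumLattice.KohnLuttingerSaddleCosets
import Literature.MathematicalPhysics.QuantumLattice.KohnLuttingerHotSpots
import Summits.HubbardSuperconductivity.HubbardSuperconductivity.Theorems.ChiralWindowCwKLChiralWindowRotPartner
import Summits.HubbardSuperconductivity.HubbardSuperconductivity.Theorems.CwKLChiralWindow.Negative.ChannelStructure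
import Summits.HubbardSuperconductivity.HubbardSuperconductivity.Theorems.WeakCouplingBCSKlThirdOrderChainParity

/-!
# KL-MARGIN-SCAN reader hubbard-klscan-idea-4 (lens «cascade»), round 7, PART A —
# the van Hove SADDLE-ROW SELECTION RULES of the `t′` Kohn–Luttinger sector kernels
# (crux idea «vh-pole-endpoint-reduction» on `stmt-HubbardSuperconductivity-0158`; companion PART B = the endpoint glue)

Along the iso-density line `δ = ⅛`, `t′ ∈ [−0.3, 0]` of HQ1 (iii) (director-hubbard g16) the float margin of `B1g` over the
next channel (margin-1 g14, SCAN-TABLE v0 TABLE C) has a POLE at the van Hove crossing `μ(⅛; t′*) = 4t′*`, `t′* ≈ −0.150`,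
and is smallest at the two ends.  This file proves the exact symmetry mechanism behind the pole, for EVERY `t′` and `μ`
(no smallness, no numerics):

* §1 a period of the band is a period of its Lindhard function (`lindhardFunction_add_of_period`, pointwise identity of the
  integrand — no change of variables, no integrability); and for every `D₄`-invariant, `2π e₀`-periodic scalar kernel `κ`,
  the row of the sector kernel `P_χ[q ↦ κ(X + q)]` at the van Hove saddle `X = (π, 0)` VANISHES IDENTICALLY for the three
  rival sectors `χ = A2g, B2g, E` (`saddleRow_A2g/B2g/E`), equals the symmetric two-saddle combination
  `(κ(X + k′) + κ(X′ + k′))/2` for `A1g` and the antisymmetric one `(κ(X + k′) − κ(X′ + k′))/2` for `B1g` (`X′ = (0, −π)`);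
  instantiated on the tree's `KLBlock.sectorKernelTP b tp μ` (`sectorKernelTP_saddleRow_*`): the bare `U` drops out of the
  `B1g` row and is fully visible in the `A1g` row.  The `k′ = X` value of the `B1g` row is `(χ₀(0) − χ₀(π,π))/2`, whose
  logarithmic asymptotics is the printed two-patch estimate `V_eff ≃ (U²/2π²t) ln|t/(μ−4t′)| (ln|t/2t′| − 1) + V₀`
  (Raghu–Kivelson–Scalapino 2010 §III); the identities here are its exact, all-`k′` form plus the statement that the
  rival rows are not small but ZERO.
* §2 the same at the level of gap functions: `A2g` and `B2g` channel functions vanish on both coordinate axes (hence at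
  all four saddles), `E` channel functions vanish at the saddles `(−π, 0)`, `(0, −π)` given `2π`-periodicity (tree:
  `inChannel_E_iff_odd`, `odd_periodic_apply_saddleX_eq_zero`).

Use (PART B, `…KlVHPole` §3–§4): the rival sectors are blind to the log-divergent Fermi-curve mass at the saddles while
`B1g` couples to it antisymmetrically, which is the mechanism offered for the NEAR-pole tier of the shape hypothesis K1
(«iso-density unimodality») that reduces the continuum statement HQ1 (iii) to its two endpoint cells.

Honest framing.  Elementary algebra of the `D₄` action on momenta plus the pointwise periodicity of the Lindhard
integrand; nothing here is an estimate.  Nothing asserts a Kohn–Luttinger margin at any `t′`, K₃, `U₀`, the window or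
superconductivity; a Kohn–Luttinger `O(U²)` channel statement is not ODLRO and nothing here proves superconductivity in
the Hubbard model; no `t′ ≠ 0` statement chains to the summit Statement (`squareDispersion 1 0`).  Zero kit.

References: S. Raghu, S. A. Kivelson, D. J. Scalapino, Phys. Rev. B 81 (2010) 224505, §II (5), (7), §III (arXiv:1002.0591,
held: chunk 7 «dominant scattering processes at q = (0,0) and Q = (π,π)»); D. P. Arovas, E. Berg, S. A. Kivelson, S. Raghu,
Ann. Rev. CMP 13 (2022) 239, Fig. 1 (a)/(b) and p. 14 (arXiv:2103.12097); R. Hlubina, Phys. Rev. B 59 (1999) 9600; tree files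
`Literature/…/KohnLuttingerSaddleCosets` (coset identities `d4Project_*_eq_cosets`), `…/KohnLuttingerHotSpots`,
`Theorems/WeakCouplingBCSKlCertTPrimeLindhardD4` (`klph_lindhardD4`), `Theorems/WeakCouplingBCSDefsKlCertTPrime` (p665271).
AI-produced formalisation (H21, cell gate-hubbard-kl, seat hubbard-klscan-idea-4 g7, 2026-08-29).
-/

noncomputable section

set_option linter.dupNamespace false

namespace Summit.HubbardSuperconductivity.HubbardSuperconductivity.Theorems.KlVHPole

open Real Set Literature.MathematicalPhysics.QuantumLattice
open Summit.HubbardSuperconductivity.HubbardSuperconductivity.Theorems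
open Summit.HubbardSuperconductivity.HubbardSuperconductivity.Theorems.CwKLChiralWindow

/-! ### §1  Periodicity of `χ₀[ε_{t′}]` and the saddle-row selection rules of the sector kernels -/

/-- `ε_{t,t′}` is `2π`-periodic in `k₀`. [folklore] -/
theorem squareDispersion_add_period_fst (t tp : ℝ) (k : Momentum) :
    squareDispersion t tp (k + mom (2 * π) 0) = squareDispersion t tp k := by
  simp [squareDispersion, Real.cos_add_two_pi]

/-- `ε_{t,t′}` is `2π`-periodic in `k₁`. [folklore] -/
theorem squareDispersion_add_period_snd (t tp : ℝ) (k : Momentum) :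
    squareDispersion t tp (k + mom 0 (2 * π)) = squareDispersion t tp k := by
  simp [squareDispersion, Real.cos_add_two_pi]

/-- **A period of the band is a period of its Lindhard function** (pointwise identity of the integrand; no change of variables,
no integrability needed). [cite: RaghuKivelsonScalapino2010, §II (5)] -/
theorem lindhardFunction_add_of_period {ε : Momentum → ℝ} {e : Momentum} (hε : ∀ k, ε (k + e) = ε k) (μ : ℝ)
    (q : Momentum) : lindhardFunction ε μ (q + e) = lindhardFunction ε μ q := by
  have h : lindhardIntegrand ε μ (q + e) = lindhardIntegrand ε μ q := by
    funext p
    have h1 : p + (q + e) = (p + q) + e := (add_assoc p q e).symm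
    simp only [lindhardIntegrand, fermiOccupation, h1, hε]
  rw [lindhardFunction, lindhardFunction, h]

/-- `χ₀[ε_{t′}](q + 2π e₀) = χ₀[ε_{t′}](q)`. [cite: RaghuKivelsonScalapino2010, §II (5)] -/
theorem lindhardTP_add_period_fst (tp μ : ℝ) (q : Momentum) :
    lindhardFunction (squareDispersion 1 tp) μ (q + mom (2 * π) 0) = lindhardFunction (squareDispersion 1 tp) μ q :=
  lindhardFunction_add_of_period (squareDispersion_add_period_fst 1 tp) μ q

/-- `χ₀[ε_{t′}](q + 2π e₁) = χ₀[ε_{t′}](q)`. [cite: RaghuKivelsonScalapino2010, §II (5)] -/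
theorem lindhardTP_add_period_snd (tp μ : ℝ) (q : Momentum) :
    lindhardFunction (squareDispersion 1 tp) μ (q + mom 0 (2 * π)) = lindhardFunction (squareDispersion 1 tp) μ q :=
  lindhardFunction_add_of_period (squareDispersion_add_period_snd 1 tp) μ q

/-- `X + s k = s (X + k)` for the saddle `X = (π, 0)` (the reflection fixes `X`). [folklore] -/
theorem saddle_add_refl (k : Momentum) : mom π 0 + reflMomentum k = reflMomentum (mom π 0 + k) := by
  ext i; fin_cases i <;> simp

/-- `X − k = r² ((X + k) − 2X)` with `2X = (2π, 0)` (`r²` is the inversion). [folklore] -/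
theorem saddle_sub_eq (k : Momentum) :
    mom π 0 - k = rotMomentum (rotMomentum ((mom π 0 + k) - mom (2 * π) 0)) := by
  ext i
  fin_cases i
  · simp; ring
  · simp

/-- `X + r k = r (X′ + k)` with `X′ = (0, −π) = r³ X` (the other saddle). [folklore] -/
theorem saddle_add_rot (k : Momentum) : mom π 0 + rotMomentum k = rotMomentum (mom 0 (-π) + k) := by
  ext i
  fin_cases i
  · simp; ring
  · simp

variable {κ : Momentum → ℝ}

/-- A `D₄`-invariant `κ` at the saddle: `κ(X + s k) = κ(X + k)`. [folklore] -/
theorem kappa_saddle_refl (hD4 : ∀ γ k, κ (d4Momentum γ k) = κ k) (k : Momentum) :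
    κ (mom π 0 + reflMomentum k) = κ (mom π 0 + k) := by
  rw [saddle_add_refl, ← d4Momentum_sr_zero, hD4]

/-- A `D₄`-invariant, `2π e₀`-periodic `κ` at the saddle: `κ(X − k) = κ(X + k)`. [folklore] -/
theorem kappa_saddle_sub (hD4 : ∀ γ k, κ (d4Momentum γ k) = κ k) (hper : ∀ k, κ (k + mom (2 * π) 0) = κ k)
    (k : Momentum) : κ (mom π 0 - k) = κ (mom π 0 + k) := by
  rw [saddle_sub_eq, ← d4Momentum_r_two, hD4]
  have h := hper ((mom π 0 + k) - mom (2 * π) 0)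
  rw [sub_add_cancel] at h
  exact h.symm

/-- A `D₄`-invariant `κ` at the saddle: `κ(X + r k) = κ(X′ + k)` with `X′ = (0, −π)`. [folklore] -/
theorem kappa_saddle_rot (hD4 : ∀ γ k, κ (d4Momentum γ k) = κ k) (k : Momentum) :
    κ (mom π 0 + rotMomentum k) = κ (mom 0 (-π) + k) := by
  rw [saddle_add_rot, ← d4Momentum_r_one, hD4]

/-- Saddle row: the unsigned stabiliser sum is `4 κ(X + k′)`. [cite: RaghuKivelsonScalapino2010, §III (17)] -/
theorem stabSum_saddle (hD4 : ∀ γ k, κ (d4Momentum γ k) = κ k) (hper : ∀ k, κ (k + mom (2 * π) 0) = κ k)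
    (k' : Momentum) : d4StabSum (fun q => κ (mom π 0 + q)) k' = 4 * κ (mom π 0 + k') := by
  simp only [d4StabSum, d4Momentum_r_zero, d4Momentum_r_two, d4Momentum_sr_zero, d4Momentum_sr_two, CwKLChiralWindow.Negative.rot_rot,
    KlThirdOrder.reflMomentum_neg, ← sub_eq_add_neg, kappa_saddle_refl hD4, kappa_saddle_sub hD4 hper]
  ring

/-- Saddle row: the reflection-signed stabiliser sum VANISHES. [cite: RaghuKivelsonScalapino2010, §III (17)] -/
theorem stabSumSigned_saddle (hD4 : ∀ γ k, κ (d4Momentum γ k) = κ k) (hper : ∀ k, κ (k + mom (2 * π) 0) = κ k)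
    (k' : Momentum) : d4StabSumSigned (fun q => κ (mom π 0 + q)) k' = 0 := by
  simp only [d4StabSumSigned, d4Momentum_r_zero, d4Momentum_r_two, d4Momentum_sr_zero, d4Momentum_sr_two, CwKLChiralWindow.Negative.rot_rot,
    KlThirdOrder.reflMomentum_neg, ← sub_eq_add_neg, kappa_saddle_refl hD4, kappa_saddle_sub hD4 hper]
  ring

/-- Saddle row: the unsigned nesting sum is `4 κ(X + r k′)`. [cite: RaghuKivelsonScalapino2010, §III (17)] -/
theorem nestSum_saddle (hD4 : ∀ γ k, κ (d4Momentum γ k) = κ k) (hper : ∀ k, κ (k + mom (2 * π) 0) = κ k)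
    (k' : Momentum) : d4NestSum (fun q => κ (mom π 0 + q)) k' = 4 * κ (mom π 0 + rotMomentum k') := by
  simp only [d4NestSum, d4Momentum_r_one, d4Momentum_r_three, d4Momentum_sr_one, d4Momentum_sr_three, CwKLChiralWindow.Negative.rot_rot,
    kl_rp_rot_neg, KlThirdOrder.reflMomentum_neg, ← sub_eq_add_neg, kappa_saddle_refl hD4, kappa_saddle_sub hD4 hper]
  ring

/-- Saddle row: the reflection-signed nesting sum VANISHES. [cite: RaghuKivelsonScalapino2010, §III (17)] -/
theorem nestSumSigned_saddle (hD4 : ∀ γ k, κ (d4Momentum γ k) = κ k) (hper : ∀ k, κ (k + mom (2 * π) 0) = κ k)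
    (k' : Momentum) : d4NestSumSigned (fun q => κ (mom π 0 + q)) k' = 0 := by
  simp only [d4NestSumSigned, d4Momentum_r_one, d4Momentum_r_three, d4Momentum_sr_one, d4Momentum_sr_three, CwKLChiralWindow.Negative.rot_rot,
    kl_rp_rot_neg, KlThirdOrder.reflMomentum_neg, ← sub_eq_add_neg, kappa_saddle_refl hD4, kappa_saddle_sub hD4 hper]
  ring

/-- **Selection rule `A2g`: the saddle row of the `A2g` sector kernel of `κ(k + k′)` vanishes identically.** [cite: RaghuKivelsonScalapino2010, §III (17)] -/
theorem saddleRow_A2g (hD4 : ∀ γ k, κ (d4Momentum γ k) = κ k) (hper : ∀ k, κ (k + mom (2 * π) 0) = κ k)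
    (k' : Momentum) : d4Project .A2g (fun q => κ (mom π 0 + q)) k' = 0 := by
  rw [d4Project_A2g_eq_cosets, stabSumSigned_saddle hD4 hper, nestSumSigned_saddle hD4 hper]; norm_num

/-- **Selection rule `B2g`: the saddle row of the `B2g` sector kernel vanishes identically.** [cite: RaghuKivelsonScalapino2010, §III (17)] -/
theorem saddleRow_B2g (hD4 : ∀ γ k, κ (d4Momentum γ k) = κ k) (hper : ∀ k, κ (k + mom (2 * π) 0) = κ k)
    (k' : Momentum) : d4Project .B2g (fun q => κ (mom π 0 + q)) k' = 0 := by
  rw [d4Project_B2g_eq_cosets, stabSumSigned_saddle hD4 hper, nestSumSigned_saddle hD4 hper]; norm_num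

/-- **Selection rule `E`: the saddle row of the `E` sector kernel vanishes identically** (`X` is time-reversal invariant mod `2π`).
[cite: RaghuKivelsonScalapino2010, §III (17)] -/
theorem saddleRow_E (hD4 : ∀ γ k, κ (d4Momentum γ k) = κ k) (hper : ∀ k, κ (k + mom (2 * π) 0) = κ k)
    (k' : Momentum) : d4Project .E (fun q => κ (mom π 0 + q)) k' = 0 := by
  rw [d4Project_E_eq_odd_part]
  simp only [← sub_eq_add_neg, kappa_saddle_sub hD4 hper, sub_self, zero_div]

/-- **Saddle row `A1g` = symmetric two-saddle combination** `(κ(X + k′) + κ(X′ + k′))/2`. [cite: RaghuKivelsonScalapino2010, §III (17)] -/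
theorem saddleRow_A1g (hD4 : ∀ γ k, κ (d4Momentum γ k) = κ k) (hper : ∀ k, κ (k + mom (2 * π) 0) = κ k)
    (k' : Momentum) :
    d4Project .A1g (fun q => κ (mom π 0 + q)) k' = (κ (mom π 0 + k') + κ (mom 0 (-π) + k')) / 2 := by
  rw [d4Project_A1g_eq_cosets, stabSum_saddle hD4 hper, nestSum_saddle hD4 hper, kappa_saddle_rot hD4]; ring

/-- **Saddle row `B1g` = antisymmetric two-saddle combination** `(κ(X + k′) − κ(X′ + k′))/2`: the d-wave row changes sign
between the two saddles, so pair scattering by the nesting vector is attractive in `B1g`. [cite: RaghuKivelsonScalapino2010, §III (17)] -/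
theorem saddleRow_B1g (hD4 : ∀ γ k, κ (d4Momentum γ k) = κ k) (hper : ∀ k, κ (k + mom (2 * π) 0) = κ k)
    (k' : Momentum) :
    d4Project .B1g (fun q => κ (mom π 0 + q)) k' = (κ (mom π 0 + k') - κ (mom 0 (-π) + k')) / 2 := by
  rw [d4Project_B1g_eq_cosets, stabSum_saddle hD4 hper, nestSum_saddle hD4 hper, kappa_saddle_rot hD4]; ring

/-- The scalar base kernel of a block at hopping `t′`: `κ_b(p) = [b.withU] + χ₀[ε_{t′}](p; μ)`, so that
`b.baseKernelTP tp μ k q = κ_b(k + q)` (`baseKernelTP_eq_kappa`). [cite: RaghuKivelsonScalapino2010, §II (7)] -/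
def klKappaTP (b : KLBlock) (tp μ : ℝ) (p : Momentum) : ℝ :=
  (if b.withU then 1 else 0) + lindhardFunction (squareDispersion 1 tp) μ p

/-- `b.baseKernelTP tp μ k q = κ_b(k + q)` (definitional). [folklore] -/
theorem baseKernelTP_eq_kappa (b : KLBlock) (tp μ : ℝ) (k q : Momentum) :
    b.baseKernelTP tp μ k q = klKappaTP b tp μ (k + q) := rfl

/-- `κ_b` is `D₄`-invariant (`klph_lindhardD4`). [cite: RaghuKivelsonScalapino2010, §II (5)] -/
theorem klKappaTP_d4 (b : KLBlock) (tp μ : ℝ) (γ : DihedralGroup 4) (p : Momentum) :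
    klKappaTP b tp μ (d4Momentum γ p) = klKappaTP b tp μ p := by
  simp only [klKappaTP, klph_lindhardD4]

/-- `κ_b` is `2π e₀`-periodic. [cite: RaghuKivelsonScalapino2010, §II (5)] -/
theorem klKappaTP_add_period_fst (b : KLBlock) (tp μ : ℝ) (p : Momentum) :
    klKappaTP b tp μ (p + mom (2 * π) 0) = klKappaTP b tp μ p := by
  simp only [klKappaTP, lindhardTP_add_period_fst]

/-- **The tree's `t′` sector kernels obey the selection rules: `A2g` saddle row `= 0`.** [cite: RaghuKivelsonScalapino2010, §III (17)] -/
theorem sectorKernelTP_saddleRow_A2g (b : KLBlock) (tp μ : ℝ) (k' : Momentum) :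
    b.sectorKernelTP tp μ .A2g (mom π 0) k' = 0 :=
  saddleRow_A2g (klKappaTP_d4 b tp μ) (klKappaTP_add_period_fst b tp μ) k'

/-- **`B2g` saddle row `= 0`.** [cite: RaghuKivelsonScalapino2010, §III (17)] -/
theorem sectorKernelTP_saddleRow_B2g (b : KLBlock) (tp μ : ℝ) (k' : Momentum) :
    b.sectorKernelTP tp μ .B2g (mom π 0) k' = 0 :=
  saddleRow_B2g (klKappaTP_d4 b tp μ) (klKappaTP_add_period_fst b tp μ) k'

/-- **`E` saddle row `= 0`.** [cite: RaghuKivelsonScalapino2010, §III (17)] -/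
theorem sectorKernelTP_saddleRow_E (b : KLBlock) (tp μ : ℝ) (k' : Momentum) :
    b.sectorKernelTP tp μ .E (mom π 0) k' = 0 :=
  saddleRow_E (klKappaTP_d4 b tp μ) (klKappaTP_add_period_fst b tp μ) k'

/-- **`B1g` saddle row** `= (χ₀(X + k′) − χ₀(X′ + k′))/2` — the bare `U` cancels. [cite: RaghuKivelsonScalapino2010, §III (17)] -/
theorem sectorKernelTP_saddleRow_B1g (b : KLBlock) (tp μ : ℝ) (k' : Momentum) :
    b.sectorKernelTP tp μ .B1g (mom π 0) k' =
      (lindhardFunction (squareDispersion 1 tp) μ (mom π 0 + k') -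
        lindhardFunction (squareDispersion 1 tp) μ (mom 0 (-π) + k')) / 2 := by
  have h := saddleRow_B1g (klKappaTP_d4 b tp μ) (klKappaTP_add_period_fst b tp μ) k'
  rw [show b.sectorKernelTP tp μ .B1g (mom π 0) k' =
    d4Project .B1g (fun q => klKappaTP b tp μ (mom π 0 + q)) k' from rfl, h]
  simp only [klKappaTP]
  ring

/-- **`A1g` saddle row** `= [b.withU] + (χ₀(X + k′) + χ₀(X′ + k′))/2` — the bare `U` is fully visible. [cite: RaghuKivelsonScalapino2010, §III (17)] -/
theorem sectorKernelTP_saddleRow_A1g (b : KLBlock) (tp μ : ℝ) (k' : Momentum) :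
    b.sectorKernelTP tp μ .A1g (mom π 0) k' = (if b.withU then 1 else 0) +
      (lindhardFunction (squareDispersion 1 tp) μ (mom π 0 + k') +
        lindhardFunction (squareDispersion 1 tp) μ (mom 0 (-π) + k')) / 2 := by
  have h := saddleRow_A1g (klKappaTP_d4 b tp μ) (klKappaTP_add_period_fst b tp μ) k'
  rw [show b.sectorKernelTP tp μ .A1g (mom π 0) k' =
    d4Project .A1g (fun q => klKappaTP b tp μ (mom π 0 + q)) k' from rfl, h]
  simp only [klKappaTP]
  ring

/-! ### §2  The same selection rules for gap functions: rival channels are blind to the saddles -/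

/-- `r (a, b) = (−b, a)` on explicit momenta. [folklore] -/
theorem rot_mom (a b : ℝ) : rotMomentum (mom a b) = mom (-b) a := by
  ext i; fin_cases i <;> simp

/-- `s (a, b) = (a, −b)` on explicit momenta. [folklore] -/
theorem refl_mom (a b : ℝ) : reflMomentum (mom a b) = mom a (-b) := by
  ext i; fin_cases i <;> simp

/-- The signed coset sums of ANY function vanish on the `k₁ = 0` axis. [folklore] -/
theorem stabSumSigned_axis_fst (ψ : Momentum → ℝ) (a : ℝ) : d4StabSumSigned ψ (mom a 0) = 0 := by
  simp only [d4StabSumSigned, d4Momentum_r_zero, d4Momentum_r_two, d4Momentum_sr_zero, d4Momentum_sr_two, rot_mom,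
    refl_mom, neg_zero]
  ring

/-- [folklore] -/
theorem nestSumSigned_axis_fst (ψ : Momentum → ℝ) (a : ℝ) : d4NestSumSigned ψ (mom a 0) = 0 := by
  simp only [d4NestSumSigned, d4Momentum_r_one, d4Momentum_r_three, d4Momentum_sr_one, d4Momentum_sr_three, rot_mom,
    refl_mom, neg_zero, neg_neg]
  ring

/-- [folklore] -/
theorem stabSumSigned_axis_snd (ψ : Momentum → ℝ) (a : ℝ) : d4StabSumSigned ψ (mom 0 a) = 0 := by
  simp only [d4StabSumSigned, d4Momentum_r_zero, d4Momentum_r_two, d4Momentum_sr_zero, d4Momentum_sr_two, rot_mom,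
    refl_mom, neg_zero, neg_neg]
  ring

/-- [folklore] -/
theorem nestSumSigned_axis_snd (ψ : Momentum → ℝ) (a : ℝ) : d4NestSumSigned ψ (mom 0 a) = 0 := by
  simp only [d4NestSumSigned, d4Momentum_r_one, d4Momentum_r_three, d4Momentum_sr_one, d4Momentum_sr_three, rot_mom,
    refl_mom, neg_zero, neg_neg]
  ring

/-- **`A2g` gap functions vanish on the `k₁ = 0` axis** (in particular at the saddles `(±π, 0)`). [folklore] -/
theorem inChannel_A2g_apply_axis_fst {ψ : Momentum → ℝ} (h : InChannel .A2g ψ) (a : ℝ) : ψ (mom a 0) = 0 := by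
  have h1 := congrFun h (mom a 0)
  rw [d4Project_A2g_eq_cosets, stabSumSigned_axis_fst, nestSumSigned_axis_fst] at h1
  norm_num at h1; linarith

/-- **`A2g` gap functions vanish on the `k₀ = 0` axis** (saddles `(0, ±π)`). [folklore] -/
theorem inChannel_A2g_apply_axis_snd {ψ : Momentum → ℝ} (h : InChannel .A2g ψ) (a : ℝ) : ψ (mom 0 a) = 0 := by
  have h1 := congrFun h (mom 0 a)
  rw [d4Project_A2g_eq_cosets, stabSumSigned_axis_snd, nestSumSigned_axis_snd] at h1
  norm_num at h1; linarith

/-- **`B2g` (`d_{xy}`) gap functions vanish on the `k₁ = 0` axis.** [folklore] -/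
theorem inChannel_B2g_apply_axis_fst {ψ : Momentum → ℝ} (h : InChannel .B2g ψ) (a : ℝ) : ψ (mom a 0) = 0 := by
  have h1 := congrFun h (mom a 0)
  rw [d4Project_B2g_eq_cosets, stabSumSigned_axis_fst, nestSumSigned_axis_fst] at h1
  norm_num at h1; linarith

/-- **`B2g` gap functions vanish on the `k₀ = 0` axis.** [folklore] -/
theorem inChannel_B2g_apply_axis_snd {ψ : Momentum → ℝ} (h : InChannel .B2g ψ) (a : ℝ) : ψ (mom 0 a) = 0 := by
  have h1 := congrFun h (mom 0 a)
  rw [d4Project_B2g_eq_cosets, stabSumSigned_axis_snd, nestSumSigned_axis_snd] at h1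
  norm_num at h1; linarith

/-- **`E` gap functions vanish at the saddle `(−π, 0)`** (zone representative of `(π, 0)`), for `ψ` `2π`-periodic in `k₀`
(tree: `inChannel_E_iff_odd`, `odd_periodic_apply_saddleX_eq_zero`). [cite: RaghuKivelsonScalapino2010, §III] -/
theorem inChannel_E_apply_saddleX {ψ : Momentum → ℝ} (h : InChannel .E ψ) (hper : ∀ k, ψ (k + mom (2 * π) 0) = ψ k) :
    ψ (mom (-π) 0) = 0 :=
  odd_periodic_apply_saddleX_eq_zero ψ ((inChannel_E_iff_odd ψ).1 h) hper

/-- **`E` gap functions vanish at the saddle `(0, −π)`**, for `ψ` `2π`-periodic in `k₁`. [cite: RaghuKivelsonScalapino2010, §III] -/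
theorem inChannel_E_apply_saddleY {ψ : Momentum → ℝ} (h : InChannel .E ψ) (hper : ∀ k, ψ (k + mom 0 (2 * π)) = ψ k) :
    ψ (mom 0 (-π)) = 0 :=
  odd_periodic_apply_saddleY_eq_zero ψ ((inChannel_E_iff_odd ψ).1 h) hper

end Summit.HubbardSuperconductivity.HubbardSuperconductivity.Theorems.KlVHPole

end
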